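import Literature.AnabelianGeometry.EtaleTheta.SettingBridgeCuspLaws
import Literature.AnabelianGeometry.EtaleTheta.SettingModel2CommutatorCuspInertiaClauses
import Literature.AnabelianGeometry.EtaleTheta.SettingModel2CommutatorCuspOrigin
import HarnessLib

/-!
# The cusp laws at the commutator-axis model `model₂ᶜ`: «unique cusp» and «inertia onto `Δ_Θ`» HOLD,
# «continuous section of `D_x ↠ G_K`» FAILS (discrete arithmetic factor) — so `¬ CuspLaws` there as well
# (non-vacuity bookkeeping for the census items C16 / C9 / C3; proof-only)

S. Mochizuki, *The étale theta function …*, Publ. RIMS **45** (2009) [EtTh], Def. 2.1 preamble p. 35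
(«the unique cusp of `X^log`», «maps the inertia group `I_x ⊆ D_x` isomorphically onto `Δ_Θ`»), Prop. 2.2 (ii)
p. 37 [cite: MochizukiEtTh2009, Def 2.1 p.35].

Cell abc-iut, layer L2 (NV lane), seat abc-iut-L2-t7 (gen 4), owner of `OncePuncturedData` / filer of
`ThetaSetting.CuspLaws`.  PROOF-ONLY (0 definitions), over abc-iut-w5-d165's `SettingModel2CommutatorCusp`
(`ThetaSetting.model₂c p`: `Π^tp_X := Γ × G_{ℚ_p}` with the arithmetic factor `Gam p` = a DISCRETE copy of
`G_{ℚ_p}`, ONE cusp with `D_x = c^Ẑ × G_{ℚ_p}`), its sequel `SettingModel2CommutatorCuspOrigin` (§5: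
`not_exists_continuous_section_model₂c` — no continuous section of `aug` over `G_K` at all) and abc-iut-w6-d059's
`SettingModel2CommutatorCuspInertiaClauses` (`not_isCompact_decomp_model₂c`), all BY NAME:

* `cusp_unique_model₂c` — leg C16 HOLDS (`Pt := Unit`);
* `map_toTheta_inertia_model₂c` is abc-iut-w5-d165's — leg C3 HOLDS (re-exported in the census conjunction only);
* `not_exists_cuspSection_model₂c` — leg C9 FAILS, in the exact shape of the `CuspLaws` field: immediate from
  abc-iut-w5-d165's `not_exists_continuous_section_model₂c` (a continuous section would inject the Krull group
  `G_K` continuously into the DISCRETE `Gam p`);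
* `not_cuspLaws_model₂c`, `isEmpty_oncePuncturedData_model₂c` (the bundle is EMPTY there too: it would make
  `D_x` compact, `OncePuncturedData.isCompact_decomp`, against `not_isCompact_decomp_model₂c`) and the census
  conjunction `cuspLaws_census_model₂c`.

UPSHOT for the census (with `SettingModelCuspLawsCensus`): across the tree's cusped models the three legs are
realised as (C16, C9, C3) = (✓, ✓, ✗) at `modelχ′`/`modelχq′` and (✓, ✗, ✓) at `model₂ᶜ`; no model in the tree
satisfies all three (that needs a non-discrete arithmetic factor normalising the commutator axis).
HONEST LABEL: semi-synthetic models, consistency bookkeeping only; nothing of [EtTh] asserted; no side taken on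
[IUTchIII] Cor. 3.12.
-/

noncomputable section

namespace Literature.AnabelianGeometry.EtaleTheta.SettingModel

open Literature.AnabelianGeometry.SemiGraphs _root_.Topology

variable (p : ℕ) [Fact p.Prime]

/-- Leg C16 at `model₂ᶜ`: the cusp is unique (`Pt := Unit`). [cite: MochizukiEtTh2009, Def 2.1 p.35] -/
theorem cusp_unique_model₂c :
    ∀ x x' : (ThetaSetting.model₂c p).Pt, (ThetaSetting.model₂c p).IsCusp x →
      (ThetaSetting.model₂c p).IsCusp x' → x' = x :=
  fun _ _ _ _ => rfl

/-- **Leg C9 FAILS at `model₂ᶜ`** in the shape of the `CuspLaws` field: `D_x = c^Ẑ × G_{ℚ_p} ↠ G_K` has NO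
continuous section (abc-iut-w5-d165's `not_exists_continuous_section_model₂c`: the arithmetic factor `Gam p` is
discrete, `G_{ℚ_p}` is not). [cite: MochizukiEtTh2009, Prop 2.2(ii) p.37] -/
theorem not_exists_cuspSection_model₂c (x : (ThetaSetting.model₂c p).Pt) :
    ¬ ∃ s : ↥(ThetaSetting.model₂c p).GK →* (ThetaSetting.model₂c p).PiTemp, Continuous s ∧
        (∀ σ, s σ ∈ (ThetaSetting.model₂c p).decomp x) ∧
        ∀ σ, (ThetaSetting.model₂c p).aug (s σ) = (σ : GQp p) :=
  fun ⟨s, hsc, _, hsa⟩ => not_exists_continuous_section_model₂c p ⟨s, hsc, hsa⟩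

/-- **`¬ CuspLaws` at `model₂ᶜ`** (through its C9 leg). [cite: MochizukiEtTh2009, Def 2.1 p.35] -/
theorem not_cuspLaws_model₂c : ¬ (ThetaSetting.model₂c p).CuspLaws := fun hL =>
  not_exists_cuspSection_model₂c p () (hL.exists_continuous_section () trivial)

/-- **The parameter bundle `OncePuncturedData` is EMPTY at `model₂ᶜ`**: it would make `D_x` compact
(`OncePuncturedData.isCompact_decomp`), against abc-iut-w6-d059's `not_isCompact_decomp_model₂c`.
[cite: MochizukiSemiAnbd2006, §6 p.71] -/
theorem isEmpty_oncePuncturedData_model₂c : IsEmpty (ThetaSetting.model₂c p).OncePuncturedData :=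
  ⟨fun e => not_isCompact_decomp_model₂c p () (e.isCompact_decomp ())⟩

/-- The truth table at `model₂ᶜ`: C16 ∧ ¬C9 (at the cusp) ∧ C3 ∧ ¬CuspLaws ∧ bundle empty.
[cite: MochizukiEtTh2009, Def 2.1 p.35] -/
theorem cuspLaws_census_model₂c :
    (∀ x x' : (ThetaSetting.model₂c p).Pt, (ThetaSetting.model₂c p).IsCusp x →
        (ThetaSetting.model₂c p).IsCusp x' → x' = x) ∧
      (∀ x : (ThetaSetting.model₂c p).Pt,
        ¬ ∃ s : ↥(ThetaSetting.model₂c p).GK →* (ThetaSetting.model₂c p).PiTemp, Continuous s ∧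
            (∀ σ, s σ ∈ (ThetaSetting.model₂c p).decomp x) ∧
            ∀ σ, (ThetaSetting.model₂c p).aug (s σ) = (σ : GQp p)) ∧
      (∀ x : (ThetaSetting.model₂c p).Pt,
        ((ThetaSetting.model₂c p).inertia x).map (ThetaSetting.model₂c p).toTheta =
          (ThetaSetting.model₂c p).DeltaTheta) ∧
      ¬ (ThetaSetting.model₂c p).CuspLaws ∧ IsEmpty (ThetaSetting.model₂c p).OncePuncturedData :=
  ⟨cusp_unique_model₂c p, not_exists_cuspSection_model₂c p, map_toTheta_inertia_model₂c p,
    not_cuspLaws_model₂c p, isEmpty_oncePuncturedData_model₂c p⟩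

end Literature.AnabelianGeometry.EtaleTheta.SettingModel

end
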